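import Summits.Ventures.PercRepro.GenQShareTables
import Summits.Ventures.PercRepro.GenQCovering
import Summits.Ventures.PercRepro.GenQOpenLayersCoreSmall
import Summits.Ventures.PercRepro.GenQOpenLayersCoreFree

/-!
# PercRepro — THE `t = 2` WINDOW OF THE `(12, 10)` ROW ON THE CORE, IN THE KERNEL (night-4, gen 3; sheet §50)

The type-`2` balance `0 ≤ Jq M G 10 2` on every coloop-free rank-`10` flat with at most `18` points of a Core
matroid, by the two charging layers with the endpoint tables of level `10` (`GenQShareTables.lean`) and the covering
count (`GenQCovering.lean`).  With `k = #(G ∖ B₀)`, `k₃` points of circuit size `3` and the deficit `2/11`: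

* the uniform bounds (`3`-circuit singletons `≥ 2/297`, others `≥ 7/176`, pairs `≥ 7/440`; demand-free `10/27`,
  `5/18`, `5/72`) carry every `(k, k₃)` except `(4, 4)` and `(4, 3)` (`charge_arith_ten`);
* `k = 4` with `k₃ = 4`, or `k₃ = 3` and a `4`-point fourth circuit, is impossible: the traces cover at most `9 < 10`
  basis points (`card_le_sum_card_fc`); with `k₃ = 3` the fourth circuit has `≥ 5` points and its singleton charges
  `≥ 26/385`: `3·2/297 + 26/385 + 6·7/440 = 0.1832 ≥ 2/11 = 0.1818`.

Main statements: `jq_two_nonneg_of_core_ten`, `TwelveTenResidueCoreFree`, `openLayersCoreFree_ten_of_residue`,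
`rls_twelve_ten_of_residue`.
-/

namespace PercRepro.GenQ

open Finset ThmH PerFlat SixFour ThmN NightThree

variable {α : Type*} [DecidableEq α] {M : Matroid α} [M.Finite]

/-! ## The charge of a demanding basis is at least `2/11` -/

/-- The arithmetic of the two layers at `q = 10` for every `(k, k₃)` with `k ∈ [2, 8]` except `(4, 4)`, `(4, 3)`. -/
theorem charge_arith_ten (k k₃ : ℕ) (hk : 2 ≤ k) (hk8 : k ≤ 8) (hk₃ : k₃ ≤ k) (hne : ¬ (k = 4 ∧ 3 ≤ k₃))
    (d₁ d₂ : ℚ) (hd₁0 : 0 ≤ d₁) (hd₁1 : d₁ ≤ 1) (hd₂0 : 0 ≤ d₂) (hd₂1 : d₂ ≤ 1) (hd₁ : k ≤ 2 → d₁ = 0)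
    (hd₂ : k ≤ 3 → d₂ = 0) :
    2 / 11 ≤ (k₃ : ℚ) * (10 / 27 - (10 / 27 - 2 / 297) * d₁) +
      ((k - k₃ : ℕ) : ℚ) * (5 / 18 - (5 / 18 - 7 / 176) * d₁) +
      ((k.choose 2 : ℕ) : ℚ) * (5 / 72 - (5 / 72 - 7 / 440) * d₂) := by
  interval_cases k <;> interval_cases k₃ <;> norm_num [Nat.choose] at hd₁ hd₂ ⊢ <;>
    first | (norm_num at hne; done) | (subst hd₁; subst hd₂; norm_num) | (subst hd₂; linarith) | linarith

/-- **Every basis `B₀` of a coloop-free `G` with `2 ≤ #(G ∖ B₀) ≤ 8` is charged at least `2/11`** at `q = 10`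
(lines `≤ 3` points). -/
theorem twelveTen_charge_ge (hs : Simple M) (hline : ∀ L ∈ flatsQ M 2, L.card ≤ 3) {G B₀ : Finset α}
    (hG : G ⊆ gr M) (hrG : M.eRk (G : Set α) = ((10 : ℕ) : ℕ∞)) (hB : B₀ ∈ basesOf M G 10) (hfree : mTr M G = 0)
    (hk : 2 ≤ (G \ B₀).card) (hk8 : (G \ B₀).card ≤ 8) : 2 / 11 ≤ charge M G 10 B₀ := by
  have hne : B₀.Nonempty := Finset.card_pos.1 (by rw [(mem_basesOf.1 hB).2.2]; norm_num)
  have hc3 : ∀ x ∈ G \ B₀, 3 ≤ (fc M x B₀).card := fun x hx =>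
    three_le_card_fc hs ((mem_basesOf.1 hB).1.trans hG) (hG (Finset.mem_sdiff.1 hx).1) (indep_of_mem_basesOf hB)
      (mem_closure_of_mem_basesOf hG hrG hB (Finset.mem_sdiff.1 hx).1) (Finset.mem_sdiff.1 hx).2 hne
  have hc11 : ∀ x ∈ G \ B₀, (fc M x B₀).card ≤ 11 := fun x _ => by
    have := card_fc_le (M := M) x B₀
    rw [(mem_basesOf.1 hB).2.2] at this
    omega
  have hU5 : ∀ P ∈ (G \ B₀).powersetCard 2, ∀ x ∈ P, ∀ y ∈ P, x ≠ y → 5 ≤ (fc M x B₀ ∪ fc M y B₀).card := by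
    intro P hP x hx y hy hxy
    have hPsub := (Finset.mem_powersetCard.1 hP).1
    exact five_le_card_union_fc hs hline hG hrG hB (by norm_num) (Finset.mem_sdiff.1 (hPsub hx)).1
      (Finset.mem_sdiff.1 (hPsub hx)).2 (Finset.mem_sdiff.1 (hPsub hy)).1 (Finset.mem_sdiff.1 (hPsub hy)).2 hxy
  -- the tables of level `8`
  have t3 := fun x (hx : x ∈ G \ B₀) (h : (fc M x B₀).card = 3) => single_bound_of_table hs hG hrG hB (by norm_num) hx
    (c₀ := 3) (c₁ := 3) (by omega) (by omega) (σ₀ := 10 / 27) (σ₁ := 2 / 297) (by norm_num)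
    (by intro c h0 h1; interval_cases c; norm_num) (by intro c h0 h1; interval_cases c; norm_num)
  have t4 := fun x (hx : x ∈ G \ B₀) (h : (fc M x B₀).card ≠ 3) => single_bound_of_table hs hG hrG hB (by norm_num) hx
    (c₀ := 4) (c₁ := 11) (by have := hc3 x hx; omega) (hc11 x hx) (σ₀ := 5 / 18) (σ₁ := 7 / 176)
    (by norm_num)
    (by intro c h0 h1; interval_cases c <;> norm_num) (by intro c h0 h1; interval_cases c <;> norm_num)
  have t5 := fun x (hx : x ∈ G \ B₀) (h : 5 ≤ (fc M x B₀).card) => single_bound_of_table hs hG hrG hB (by norm_num) hx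
    (c₀ := 5) (c₁ := 11) h (hc11 x hx) (σ₀ := 5 / 18) (σ₁ := 26 / 385) (by norm_num)
    (by intro c h0 h1; interval_cases c <;> norm_num) (by intro c h0 h1; interval_cases c <;> norm_num)
  have tp := fun P (hP : P ∈ (G \ B₀).powersetCard 2) => pair_bound_of_table hs hG hrG hB (by norm_num) hP (u₀ := 5)
    (by norm_num) (hU5 P hP) (τ₀ := 5 / 72) (τ₁ := 7 / 440) (by norm_num)
    (by intro u h0 h1; interval_cases u <;> norm_num [Nat.choose])
    (by intro u h0 h1; interval_cases u <;> norm_num [Nat.choose])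
  set K := G \ B₀ with hK
  set K₃ := K.filter (fun x => (fc M x B₀).card = 3) with hK₃
  set D₁ : ℚ := if K.card ≤ 2 then 0 else 1 with hD₁
  set D₂ : ℚ := if K.card ≤ 3 then 0 else 1 with hD₂
  have hK₃K : K₃ ⊆ K := Finset.filter_subset _ _
  have hK₃le := Finset.card_le_card hK₃K
  by_cases hspecial : K.card = 4 ∧ 3 ≤ K₃.card
  · obtain ⟨hk4, hk₃3⟩ := hspecial
    have hD : D₁ = 1 := by rw [hD₁, if_neg (by omega)]
    have hD' : D₂ = 1 := by rw [hD₂, if_neg (by omega)]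
    have hS := card_le_sum_card_fc hG hrG hB hfree
    rw [← hK] at hS
    by_cases hk₃4 : K₃.card = 4
    · -- four `3`-circuits cannot cover ten basis points
      exfalso
      have hK₃eq : K₃ = K := Finset.eq_of_subset_of_card_le hK₃K (by omega)
      have hall : ∀ x ∈ K, (fc M x B₀).card - 1 = 2 := by
        intro x hx
        rw [← hK₃eq, hK₃, Finset.mem_filter] at hx
        omega
      rw [Finset.sum_congr rfl hall, Finset.sum_const, smul_eq_mul, hk4] at hS
      omega
    · -- `k₃ = 3`: the fourth circuit `C_z` has `≥ 5` points
      have hk₃3' : K₃.card = 3 := by omega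
      have hone : (K \ K₃).card = 1 := by rw [Finset.card_sdiff_of_subset hK₃K]; omega
      obtain ⟨z, hz⟩ := Finset.card_eq_one.1 hone
      have hzK : z ∈ K := (Finset.mem_sdiff.1 (by rw [hz]; exact Finset.mem_singleton_self z)).1
      have honly : ∀ x ∈ K, (fc M x B₀).card ≠ 3 → x = z := by
        intro x hx h3
        have : x ∈ K \ K₃ := Finset.mem_sdiff.2 ⟨hx, fun h => h3 (Finset.mem_filter.1 h).2⟩
        rw [hz, Finset.mem_singleton] at this
        exact this
      have hz5 : 5 ≤ (fc M z B₀).card := by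
        by_contra hlt
        push Not at hlt
        have hS' : ∑ x ∈ K, ((fc M x B₀).card - 1) ≤ 9 := by
          rw [← Finset.sum_sdiff hK₃K, hz, Finset.sum_singleton]
          have : ∑ x ∈ K₃, ((fc M x B₀).card - 1) = ∑ _x ∈ K₃, 2 := by
            apply Finset.sum_congr rfl
            intro x hx
            rw [hK₃, Finset.mem_filter] at hx
            omega
          rw [this, Finset.sum_const, smul_eq_mul, hk₃3']
          omega
        omega
      have h := charge_ge_of_bounds hs hG hrG hB (by norm_num) (10 / 27 - (10 / 27 - 2 / 297) * D₁)
        (5 / 18 - (5 / 18 - 26 / 385) * D₁) (5 / 72 - (5 / 72 - 7 / 440) * D₂)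
        (fun x hx h3 => t3 x hx h3)
        (fun x hx h3 => t5 x hx (by rw [honly x hx h3]; exact hz5))
        (fun P hP => tp P hP)
      rw [hk4, hk₃3', hD, hD'] at h
      norm_num [Nat.choose] at h ⊢
      linarith
  · have h := charge_ge_of_bounds hs hG hrG hB (by norm_num) (10 / 27 - (10 / 27 - 2 / 297) * D₁)
      (5 / 18 - (5 / 18 - 7 / 176) * D₁) (5 / 72 - (5 / 72 - 7 / 440) * D₂) t3 t4 tp
    have harith := charge_arith_ten K.card K₃.card hk hk8 hK₃le hspecial D₁ D₂
      (by rw [hD₁]; split_ifs <;> norm_num) (by rw [hD₁]; split_ifs <;> norm_num)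
      (by rw [hD₂]; split_ifs <;> norm_num) (by rw [hD₂]; split_ifs <;> norm_num)
      (fun h2 => by rw [hD₁, if_pos h2]) (fun h3 => by rw [hD₂, if_pos h3])
    linarith

/-! ## The `t = 2` window of `(12, 10)` -/

/-- **The type-`2` balance on every coloop-free rank-`10` flat with at most `18` points when lines have `≤ 3`
points.** -/
theorem jq_two_nonneg_of_lines_ten (hs : Simple M) (hline : ∀ L ∈ flatsQ M 2, L.card ≤ 3) {G : Finset α}
    (hG : G ∈ flatsQ M 10) (hfree : mTr M G = 0) (hcard : G.card ≤ 18) : 0 ≤ Jq M G 10 2 := by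
  have hGg : G ⊆ gr M := (mem_flatsQ.1 hG).1
  have hrG : M.eRk (G : Set α) = ((10 : ℕ) : ℕ∞) := (mem_flatsQ.1 hG).2.2
  apply Jq_two_nonneg_of_charge
  intro B₀ hB
  obtain ⟨hBG, hr, hc⟩ := mem_basesOf.1 hB
  have hkc : (G \ B₀).card = G.card - 10 := by rw [Finset.card_sdiff_of_subset hBG, hc]
  have hw : -(2 / 11 : ℚ) ≤ wTwo M G B₀ 10 := by
    unfold wTwo wInf
    have hm : mTr M B₀ ≤ 10 := mTr_le_of_eRk_eq (hBG.trans hGg) hr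
    have hm' : (mTr M B₀ : ℚ) ≤ 10 := by exact_mod_cast hm
    have hwinf : (1 : ℚ) / 11 ≤ 1 / (1 + (mTr M B₀ : ℚ)) := one_div_le_one_div_of_le (by positivity) (by linarith)
    have hd := dem_le_one (M := M) G B₀ 2
    push_cast
    nlinarith
  by_cases hk : (G \ B₀).card ≤ 1
  · have hd0 : dem M G 2 B₀ = 0 := dem_two_eq_zero_of_card_le_one hk
    have hw0 : 0 ≤ wTwo M G B₀ 10 := by
      unfold wTwo
      rw [hd0]
      have := wInf_pos (M := M) B₀
      push_cast
      nlinarith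
    have hch : 0 ≤ charge M G 10 B₀ := by
      have := charge_ge_sum_of_subset (q := 10) hs hGg (by norm_num) B₀ (T := ∅) (Finset.empty_subset _)
      rwa [Finset.sum_empty] at this
    linarith
  · have hch := twelveTen_charge_ge hs hline hGg hrG hB hfree (by omega) (by omega)
    linarith

/-- **THE `t = 2` WINDOW OF THE `(12, 10)` ROW ON THE CORE**: on every Core matroid, every coloop-free rank-`10`
flat with at most `18` points satisfies the type-`2` balance `0 ≤ Jq M G 10 2`. -/
theorem jq_two_nonneg_of_core_ten {γ : Type} [DecidableEq γ] {M : Matroid γ} [M.Finite] {p : ℕ} (hc : Core M p)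
    {G : Finset γ} (hG : G ∈ flatsQ M 10) (hfree : mTr M G = 0) (hcard : G.card ≤ 18) : 0 ≤ Jq M G 10 2 :=
  jq_two_nonneg_of_lines_ten (simple_of_core hc) (fun _ hL => card_le_three_of_line_of_core hc hL) hG hfree hcard

/-- **The residue of the row `(12, 10)` at level `10`** on the coloop-free flats: the type-`1` balance when
`12 ≤ #G ≤ 17` and the type-`3 … 9` balances — `OpenLayersCoreFree 10` without its type-`2` clause. -/
def TwelveTenResidueCoreFree : Prop :=
  ∀ {β : Type} [DecidableEq β] (M : Matroid β) [M.Finite] (G : Finset β), Core M 12 → G ∈ flatsQ M 10 →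
    mTr M G = 0 → (12 ≤ G.card → G.card ≤ 17 → 0 ≤ Jq M G 10 1) ∧ (∀ t, 3 ≤ t → t ≤ 9 → 0 ≤ Jq M G 10 t)

/-- **`OpenLayersCoreFree 10` from the residue**: the type-`2` window `(g − 10)(g − 7) < 108`, i.e. `g ≤ 18`, is the
kernel theorem `jq_two_nonneg_of_core_ten`; the type-`1` window `(g − 10)·13 + 1 < 100` is `g ≤ 17`. -/
theorem openLayersCoreFree_ten_of_residue (h : TwelveTenResidueCoreFree) : OpenLayersCoreFree 10 := by
  intro β _ M _ G hc hG _ hfree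
  obtain ⟨h1, h3⟩ := h M G hc hG hfree
  refine ⟨fun _ h12 hwin => h1 h12 (by norm_num at hwin; omega), fun hwin => ?_,
    fun t ht3 ht => h3 t ht3 (by omega)⟩
  apply jq_two_nonneg_of_core_ten hc hG hfree
  by_contra hg
  push Not at hg
  have h9 : 9 ≤ G.card - 10 := by omega
  have h12 : 12 ≤ G.card - 10 + 3 := by omega
  have := Nat.mul_le_mul h9 h12
  omega

/-- **C-025 at `(12, 10)` on every finite matroid** from the Core-typed layers of levels `5 … 9`, the level-`9`
trace sums and the `(12, 10)` residue on coloop-free flats. -/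
theorem rls_twelve_ten_of_residue {α : Type} [DecidableEq α] (h5 : OpenLayersCore 5) (h6 : OpenLayersCore 6)
    (h7 : OpenLayersCore 7) (h8 : OpenLayersCore 8) (h9 : OpenLayersCore 9) (htr : TraceSumsCore 9)
    (h10 : TwelveTenResidueCoreFree) (M : Matroid α) [M.Finite] : RLS M 12 10 := by
  refine rls_succ_succ_of_openLayersCore 10 (by norm_num) ?_ M
  intro q' hq'5 hq'
  rcases (show q' = 5 ∨ q' = 6 ∨ q' = 7 ∨ q' = 8 ∨ q' = 9 ∨ q' = 10 by omega) with
    rfl | rfl | rfl | rfl | rfl | rfl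
  · exact h5
  · exact h6
  · exact h7
  · exact h8
  · exact h9
  · exact openLayersCore_succ_of_free (by norm_num) htr (openLayersCoreFree_ten_of_residue h10)

end PercRepro.GenQ
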